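import Literature.MathematicalPhysics.QuantumFieldTheory.Balaban1983to89.B8SockHFPWindows

/-!
# `Balaban1983to89.B8SockP5uEWindows` — [Balaban1985RegularSpaces] Prop. 5 (1.109) p. 94 with Thm 4 p. 88: THE SCALAR WINDOWS OF THE REPAIRED
# UNIQUENESS SOCKET'S PROVIDER FROM ONE GUARD, AT A FIXED CONTRACTION RADIUS — «To get a best uniqueness result we have to take a largest possible
# α₄. It is independent of α₀ + α₁» (p. 94)

statement-level skeleton of published theorems with citation tags; proofs where landed; nothing here is a claim about the
Yang–Mills mass gap

PDF held: `paper:balaban1985-cmp99-regular-spaces-gauge-fixing` (journal page = PDF page + 74); p. 93 ((1.102)–(1.103)), p. 94 ((1.106), Prop. 5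
(1.107)–(1.109) and the sentence on the choice of α₄).

WHY THIS FILE (cell `pub-ymgap`, seat `pub-ymgap-dag-n04-b` g5; REACTIVATE №14 «the `SockP5u` provider»).  The provider of the repaired uniqueness
socket `B8LeafModelZdSockP5uE.SockP5uE L B₀ cP cu …` at one member, `B8SockP5uEOfLettersU.sockP5uE_of_lettersU`, displays a WINDOWS FAMILY below the
guard `α₀ + α₁ ≤ c_P`: the 27 windows of the existence side (`B8SockHFPWindows.hfpWindows_of_guard`, `pub-ymgap-dag-n05-d`) read at a FIXED
contraction radius `α₄` (not the existence side's `α₄ = 8B₀′c⋆`, which shrinks with `α₀ + α₁` and could not serve the socket's fixed radius `c_u` —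
this seat's correction in `B8SockP5uEAssembly` v1.1) plus the two uniqueness windows `lE ≤ ½` and `c_u + hE ≤ ¼α₄`.  THIS FILE proves that family
is inhabited: ONE radius `α₄(d, L, B_G, B_R, B₀′_H, B₂′) > 0`, ONE socket radius `c_u = α₄/8` (print's c₃) and ONE threshold `c_P > 0` serve all
29 windows — print's «there exists a constant c₂ … c₃ depending on d and L only» (here: on the displayed constants of [4] as well).

WHAT THIS FILE PROVES (kernel, 0 sorry, theorems only): `mWc_le_of_radius`, `KWc_le_of_radius` (the sizes (1.99)/(1.106) at a radius `a ≤ 1`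
with datum terms `≤ a²`: `m_W ≤ C_m·a²`, `K_W ≤ C_K·a`, `C_m = 6/5 + 4B₂′C′₂ + 21d`, `C_K = 36 + 64B₂′C′₂ + 1405d`), and
**`uniqWindows_of_guard`** — for `d, L ≥ 1`, `B₀ > 0` with `2 ≤ 5dLB₀`, `B₀′_H > 0`, `B₂′, B_G, B_R ≥ 0`, `c_b9 > 0`: `∃ α₄ c_u c_P > 0` such that for
all `α₀, α₁ > 0` with `α₀ + α₁ ≤ c_P`, at `c⋆ = 5dLB₀(α₀ + α₁)`, `c_B = L·c⋆`, `c_DA = dL²·c⋆`, `h_E = B₀′_H·C′₂(40d·c_B + α₄)α₄`,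
`h_E₂ = B₂′·C′₂(40d·c_B + α₄)α₄`, `l_E = B₀′_H·4C′₂(40d·c_B + 2α₄)`, `l_E₂ = B₂′·4C′₂(40d·c_B + 2α₄)`, the 29 windows of `sockP5uE_of_lettersU`'s
`hwin` hold, in its order.  Device: the seventeen `α₄`-free windows are those of `hfpWindows_of_guard` (BY NAME, at an auxiliary `B₀′`), the twelve
`α₄`-dependent ones follow from `Dᵢ·α₄ ≤ 1` (nine coefficients `Dᵢ`) and `c_B, 40d·c_B, c_DA ≤ α₄²` (two more thresholds on `α₀ + α₁`).

HONEST SCOPE.  Scalar bookkeeping only; merely sufficient constants (no optimisation of c₂, c₃).  Count-neutral; N05 NOT discharged; nothing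
continuum / ℝ⁴ / OS / mass-gap / Clay.  Unit `pub-ymgap-dag-n04-b` (g5), 2026-08-26.
-/

noncomputable section

open NormedSpace

namespace Literature.MathematicalPhysics.QuantumFieldTheory.Balaban1983to89.B8SockP5uEWindows

open B7Prop2Explicit (C0 c2')
open B7Prop3Flat (c3)
open B7Prop10General (C6 C4G)
open B7Prop9Flat (C5')
open B7Prop10Flat (C5'_nonneg)
open B8Ineq125Concrete (C2p)
open B8Prop5ContractionKLevel (mWc Mc KWc Kc)
open B8Thm4Windows (mul_le_one_of_le_inv)
open B7ConclGaugeLin (two_le_C6' C4G_pos')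
open B8SockHFPWindows (C2p_pos mWc_mono KWc_mono hfpWindows_of_guard)

variable {d L : ℕ}

/-! ## §1 The sizes (1.99) and (1.106) at a fixed radius `a ≤ 1` with datum terms `≤ a²` -/

/-- **`m_W ≤ C_m·a²` at radius `a`**: `m_W(a/3, a², 2B₂′C′₂a², a²) ≤ (6/5 + 4B₂′C′₂ + 21d)·a²` for `a ≤ 1` (`82/9 + 34a/3 ≤ 21`; only `a ≤ 1` is read).
[cite: Balaban1985RegularSpaces, (1.99) p.93] -/
theorem mWc_le_of_radius {B₂' a : ℝ} (ha1 : a ≤ 1) :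
    mWc d (a / 3) (a ^ 2) (2 * B₂' * C2p d * a ^ 2) (a ^ 2) ≤ (6 / 5 + 4 * B₂' * C2p d + 21 * d) * a ^ 2 := by
  have hd : (0 : ℝ) ≤ d := Nat.cast_nonneg d
  have ha3 : a ^ 3 ≤ a ^ 2 := by nlinarith only [ha1, sq_nonneg a]
  unfold mWc
  have h1 : (d : ℝ) * (82 * (a / 3) ^ 2 + 34 * a ^ 2 * (a / 3)) ≤ d * (21 * a ^ 2) := by
    refine mul_le_mul_of_nonneg_left ?_ hd
    nlinarith only [ha3, sq_nonneg a]
  linarith only [h1]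

/-- **`K_W ≤ C_K·a` at radius `a`**: `K_W(a/3, a², 2B₂′C′₂a², a², 12B₂′C′₂a, 2, 2) ≤ (36 + 64B₂′C′₂ + 1405d)·a` for `0 ≤ a ≤ 1`.
[cite: Balaban1985RegularSpaces, (1.106) p.94] -/
theorem KWc_le_of_radius {B₂' a : ℝ} (hB₂' : 0 ≤ B₂') (ha0 : 0 ≤ a) (ha1 : a ≤ 1) :
    KWc d (a / 3) (a ^ 2) (2 * B₂' * C2p d * a ^ 2) (a ^ 2) (12 * B₂' * C2p d * a) 2 2 ≤ (36 + 64 * B₂' * C2p d + 1405 * d) * a := by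
  have hd : (0 : ℝ) ≤ d := Nat.cast_nonneg d
  have hC2 : 0 ≤ C2p d := (C2p_pos (d := d)).le
  have ha2 : a ^ 2 ≤ a := by nlinarith only [ha0, ha1]
  have ha3 : a ^ 3 ≤ a := by nlinarith only [ha0, ha1, ha2]
  unfold KWc
  have h1 : (d : ℝ) * (438 * (a / 3) * 2 + 1968 * (a / 3) ^ 2 * 2 + 68 * a ^ 2 * 2 + 808 * a ^ 2 * (a / 3) * 2) ≤ d * (1405 * a) := by
    refine mul_le_mul_of_nonneg_left ?_ hd
    nlinarith only [ha2, ha3, ha0]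
  have h2 : 2 * (12 * B₂' * C2p d * a) + 10 * (2 * B₂' * C2p d * a ^ 2) * 2 ≤ 64 * B₂' * C2p d * a := by
    have hbc : 0 ≤ B₂' * C2p d := mul_nonneg hB₂' hC2
    nlinarith only [ha2, hbc]
  nlinarith only [h1, h2, ha2]

/-! ## §2 THE WINDOWS FROM ONE GUARD, at a fixed contraction radius -/

/-- **PROPOSITION 5's «there exist positive constants c₂, c₃» FOR THE REPAIRED UNIQUENESS SOCKET** — all 29 scalar windows of
`B8SockP5uEOfLettersU.sockP5uE_of_lettersU` from ONE guard, at ONE contraction radius `α₄ > 0` and ONE socket radius `c_u = α₄/8`, both FIXED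
(independent of `α₀ + α₁`, p. 94).  For `d, L ≥ 1`, `B₀ > 0` with `2 ≤ 5dLB₀`, [4]-letters constants `B₀′_H > 0`, `B₂′, B_G, B_R ≥ 0` and a b9 threshold
`c_b9 > 0`: `∃ α₄ c_u c_P > 0` such that for all `α₀, α₁ > 0` with `α₀ + α₁ ≤ c_P`, at `c⋆ = 5dLB₀(α₀ + α₁)`, `c_B = L·c⋆`, `c_DA = dL²·c⋆` and the Sect. E
sizes `h_E, h_E₂, l_E, l_E₂` at `(c_B, α₄)`: Proposition 3's four windows, the b9 thresholds, the JOIN's windows (α₀-windows, `c_B`-windows, the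
Sect. E windows `200C₆·2α₄ ≤ 1`, `12000(d+1)L·2α₄ ≤ 1`, `C₄^G(α₀ + 40d·c_B + 8α₄) ≤ 1`, `40d·c_B + α₄ ≤ 1/(4B₀′_H·2C′₂)`, `2C₆(40d·c_B + 4α₄) ≤ ⅛`,
`c_B ≤ 1/13`, `α₄/4 + h_E ≤ 1/24`, `≤ 1/140`, `10(α₄/4 + h_E)B_R ≤ ½`, (1.103) `B_G·M ≤ α₄/4`, (1.106) `B_G·K ≤ ½`) and the two uniqueness windows
`l_E ≤ ½`, `c_u + h_E ≤ ¼α₄`.  Device: `hfpWindows_of_guard` (BY NAME) for the seventeen `α₄`-free windows; `Dᵢ·α₄ ≤ 1` for nine coefficients and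
`40d·c_B, c_DA ≤ α₄²` below `c_P` for the rest (§1). [cite: Balaban1985RegularSpaces, Prop. 5 p.94 («c₂, c₃ depending on d and L only»; «largest possible α₄ … independent of α₀ + α₁»), (1.102)–(1.103) p.93, (1.106) p.94] -/
theorem uniqWindows_of_guard (hd : 1 ≤ d) (hL : 1 ≤ L) {B₀ B₀'H B₂' BG BR cB9 : ℝ} (hB₀ : 0 < B₀) (hB : 2 ≤ 5 * (d : ℝ) * L * B₀)
    (hB₀'H : 0 < B₀'H) (hB₂' : 0 ≤ B₂') (hBG : 0 ≤ BG) (hBR : 0 ≤ BR) (hcB9 : 0 < cB9) :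
    ∃ α₄ cu cP : ℝ, 0 < α₄ ∧ 0 < cu ∧ 0 < cP ∧ ∀ α₀ α₁ : ℝ, 0 < α₀ → 0 < α₁ → α₀ + α₁ ≤ cP →
      ∀ cs cB cDA hE hE₂ lE lE₂ : ℝ, cs = 5 * (d : ℝ) * L * B₀ * (α₀ + α₁) → cB = L * cs → cDA = (d : ℝ) * (L : ℝ) ^ 2 * cs →
      hE = B₀'H * (C2p d * (40 * d * cB + α₄) * α₄) → hE₂ = B₂' * (C2p d * (40 * d * cB + α₄) * α₄) →
      lE = B₀'H * (4 * C2p d * (40 * d * cB + 2 * α₄)) → lE₂ = B₂' * (4 * C2p d * (40 * d * cB + 2 * α₄)) →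
      36 * d * B₀ * cs ≤ 1 / 2 ∧
      8 * (131072 * ((d : ℝ) + 1) ^ 2) * Real.exp (4 * (800 * ((d : ℝ) + 1) ^ 2 * ((d : ℝ) + 4)) * α₀) ≤ 16 * (131072 * ((d : ℝ) + 1) ^ 2) ∧
      2 * cs ^ 2 + 20 * d * α₀ * cs + 2 * (16 * (131072 * ((d : ℝ) + 1) ^ 2)) * cs ^ 2 ≤ α₀ + α₁ ∧
      (d : ℝ) * L * α₁ ≤ 1 / 8 ∧
      α₀ ≤ cB9 ∧ cs ≤ cB9 ∧
      C0 d * α₀ ≤ 1 / 3 ∧ 4 * α₀ ≤ c2' d L ∧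
      Real.exp (4 * (800 * ((d : ℝ) + 1) ^ 2 * ((d : ℝ) + 4)) * α₀) * (1 + 8 * (131072 * ((d : ℝ) + 1) ^ 2) * cB) ≤ 2 ∧
      2 * cB ≤ c3 d L ∧ 2048 * (d : ℝ) * cB ≤ 1 ∧ 40 * d * cB ≤ 1 / 200 ∧
      200 * C6 d * (2 * α₄) ≤ 1 ∧ 12000 * ((d : ℝ) + 1) * L * (2 * α₄) ≤ 1 ∧
      C4G d L * (α₀ + 40 * d * cB + 4 * (2 * α₄)) ≤ 1 ∧
      1024 * ((d : ℝ) + 1) * ((d : ℝ) + 4) * L ^ 2 * α₀ ≤ 1 ∧ 32 * ((d : ℝ) + 1) ^ 2 * C6 d * L ^ 2 * α₀ ≤ 1 ∧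
      16 * d * C5' d * C6 d * (L : ℝ) ^ 2 * α₀ ≤ 1 ∧ 8 * d * C6 d * L * α₀ ≤ 1 ∧
      40 * d * cB + α₄ ≤ 1 / (4 * B₀'H * (2 * C2p d)) ∧ 2 * C6 d * (40 * d * cB + 4 * α₄) ≤ 1 / 8 ∧
      cB ≤ 1 / 13 ∧ α₄ / 4 + hE ≤ 1 / 24 ∧ α₄ / 4 + hE ≤ 1 / 140 ∧ 10 * (α₄ / 4 + hE) * BR ≤ 1 / 2 ∧
      BG * Mc d BR (α₄ / 4 + hE) cB hE₂ cDA ≤ α₄ / 4 ∧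
      BG * Kc d BR (α₄ / 4 + hE) cB hE₂ cDA lE₂ (1 + lE) (1 + lE) ≤ 1 / 2 ∧
      lE ≤ 1 / 2 ∧ cu + hE ≤ α₄ / 4 := by
  -- shorthand
  have hd' : (1 : ℝ) ≤ d := by exact_mod_cast hd
  have hL' : (1 : ℝ) ≤ L := by exact_mod_cast hL
  have hd0 : (0 : ℝ) < d := by linarith only [hd']
  have hL0 : (0 : ℝ) < L := by linarith only [hL']
  have hC6 : (2 : ℝ) ≤ C6 d := two_le_C6'
  have hC60 : (0 : ℝ) ≤ C6 d := by linarith only [hC6]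
  have hC2 : 0 < C2p d := C2p_pos
  have hC4 : 0 ≤ C4G d L := (C4G_pos' d L).le
  -- the existence side's windows at an auxiliary `B₀′` (only the α₄-free ones are read)
  obtain ⟨B₀'', hB₀''⟩ : ∃ B₀'' : ℝ, B₀'' = 3 * (2 * (d : ℝ) * (L : ℝ) ^ 2) * BG * BR + 1 := ⟨_, rfl⟩
  have hB₀''pos : 0 < B₀'' := by rw [hB₀'']; positivity
  have hfree : 3 * (2 * (d : ℝ) * (L : ℝ) ^ 2) * BG * BR ≤ B₀'' := by rw [hB₀'']; linarith only
  obtain ⟨cP₀, hcP₀, hw₀⟩ := hfpWindows_of_guard hd hL hB₀ hB₀''pos hB hB₀'H hB₂' hBG hBR hcB9 hfree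
  -- scales
  obtain ⟨K₁, hK₁⟩ : ∃ K₁ : ℝ, K₁ = 5 * d * L * B₀ := ⟨_, rfl⟩
  obtain ⟨Kb, hKb⟩ : ∃ Kb : ℝ, Kb = L * K₁ := ⟨_, rfl⟩
  obtain ⟨KDA, hKDA⟩ : ∃ KDA : ℝ, KDA = d * (L : ℝ) ^ 2 * K₁ := ⟨_, rfl⟩
  have hK₁0 : 0 < K₁ := by rw [hK₁]; positivity
  have hKb0 : 0 < Kb := by rw [hKb]; positivity
  have hKDA0 : 0 < KDA := by rw [hKDA]; positivity
  -- the size constants of §1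
  obtain ⟨Cm, hCm⟩ : ∃ Cm : ℝ, Cm = 6 / 5 + 4 * B₂' * C2p d + 21 * d := ⟨_, rfl⟩
  obtain ⟨Ck, hCk⟩ : ∃ Ck : ℝ, Ck = 36 + 64 * B₂' * C2p d + 1405 * d := ⟨_, rfl⟩
  have hCm0 : 0 ≤ Cm := by rw [hCm]; positivity
  have hCk0 : 0 ≤ Ck := by rw [hCk]; positivity
  -- the radius: `Dᵢ·α₄ ≤ 1` for nine coefficients
  obtain ⟨E1, hE1⟩ : ∃ E1 : ℝ, E1 = 1 := ⟨_, rfl⟩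
  obtain ⟨E2, hE2⟩ : ∃ E2 : ℝ, E2 = 400 * C6 d := ⟨_, rfl⟩
  obtain ⟨E3, hE3⟩ : ∃ E3 : ℝ, E3 = 24000 * ((d : ℝ) + 1) * L := ⟨_, rfl⟩
  obtain ⟨E4, hE4⟩ : ∃ E4 : ℝ, E4 = 10 * C4G d L := ⟨_, rfl⟩
  obtain ⟨E5, hE5⟩ : ∃ E5 : ℝ, E5 = 32 * B₀'H * C2p d := ⟨_, rfl⟩
  obtain ⟨E6, hE6⟩ : ∃ E6 : ℝ, E6 = 50 := ⟨_, rfl⟩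
  obtain ⟨E7, hE7⟩ : ∃ E7 : ℝ, E7 = 8 * BR := ⟨_, rfl⟩
  obtain ⟨E8, hE8⟩ : ∃ E8 : ℝ, E8 = 8 * BG * BR * Cm := ⟨_, rfl⟩
  obtain ⟨E9, hE9⟩ : ∃ E9 : ℝ, E9 = 4 * BG * BR * (Ck + 40 * BR * Cm) := ⟨_, rfl⟩
  have g1 : 0 ≤ E1 := by rw [hE1]; norm_num
  have g2 : 0 ≤ E2 := by rw [hE2]; positivity
  have g3 : 0 ≤ E3 := by rw [hE3]; positivity
  have g4 : 0 ≤ E4 := by rw [hE4]; positivity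
  have g5 : 0 ≤ E5 := by rw [hE5]; positivity
  have g6 : 0 ≤ E6 := by rw [hE6]; norm_num
  have g7 : 0 ≤ E7 := by rw [hE7]; positivity
  have g8 : 0 ≤ E8 := by rw [hE8]; positivity
  have g9 : 0 ≤ E9 := by rw [hE9]; positivity
  have tpos : ∀ {D : ℝ}, 0 ≤ D → 0 < 1 / (D + 1) := fun h => by positivity
  obtain ⟨a, ha⟩ : ∃ a : ℝ, a = min (1 / (E1 + 1)) (min (1 / (E2 + 1)) (min (1 / (E3 + 1)) (min (1 / (E4 + 1)) (min (1 / (E5 + 1))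
    (min (1 / (E6 + 1)) (min (1 / (E7 + 1)) (min (1 / (E8 + 1)) (1 / (E9 + 1))))))))) := ⟨_, rfl⟩
  have ha0 : 0 < a := by
    rw [ha]
    exact lt_min (tpos g1) (lt_min (tpos g2) (lt_min (tpos g3) (lt_min (tpos g4) (lt_min (tpos g5) (lt_min (tpos g6) (lt_min (tpos g7)
      (lt_min (tpos g8) (tpos g9))))))))
  have dev : ∀ {D : ℝ}, 0 ≤ D → a ≤ 1 / (D + 1) → D * a ≤ 1 := fun {D} hD h =>
    mul_le_one_of_le_inv (by linarith only [hD] : D ≤ D + 1) (by linarith only [hD]) ha0.le h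
  have ha' : a ≤ min (1 / (E1 + 1)) (min (1 / (E2 + 1)) (min (1 / (E3 + 1)) (min (1 / (E4 + 1)) (min (1 / (E5 + 1))
    (min (1 / (E6 + 1)) (min (1 / (E7 + 1)) (min (1 / (E8 + 1)) (1 / (E9 + 1))))))))) := le_of_eq ha
  have f1 : E1 * a ≤ 1 := dev g1 (ha'.trans (min_le_left _ _))
  have hb2 := ha'.trans (min_le_right _ _)
  have f2 : E2 * a ≤ 1 := dev g2 (hb2.trans (min_le_left _ _))
  have hb3 := hb2.trans (min_le_right _ _)
  have f3 : E3 * a ≤ 1 := dev g3 (hb3.trans (min_le_left _ _))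
  have hb4 := hb3.trans (min_le_right _ _)
  have f4 : E4 * a ≤ 1 := dev g4 (hb4.trans (min_le_left _ _))
  have hb5 := hb4.trans (min_le_right _ _)
  have f5 : E5 * a ≤ 1 := dev g5 (hb5.trans (min_le_left _ _))
  have hb6 := hb5.trans (min_le_right _ _)
  have f6 : E6 * a ≤ 1 := dev g6 (hb6.trans (min_le_left _ _))
  have hb7 := hb6.trans (min_le_right _ _)
  have f7 : E7 * a ≤ 1 := dev g7 (hb7.trans (min_le_left _ _))
  have hb8 := hb7.trans (min_le_right _ _)
  have f8 : E8 * a ≤ 1 := dev g8 (hb8.trans (min_le_left _ _))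
  have f9 : E9 * a ≤ 1 := dev g9 (hb8.trans (min_le_right _ _))
  rw [hE1] at f1; rw [hE2] at f2; rw [hE3] at f3; rw [hE4] at f4; rw [hE5] at f5; rw [hE6] at f6; rw [hE7] at f7; rw [hE8] at f8
  rw [hE9] at f9
  have ha1 : a ≤ 1 := by linarith only [f1]
  have ha2 : a ^ 2 ≤ a := by nlinarith only [ha0, ha1]
  -- the threshold: the existence side's, and `40d·c_B ≤ α₄²`, `c_DA ≤ α₄²`
  obtain ⟨T1, hT1⟩ : ∃ T1 : ℝ, T1 = a ^ 2 / (40 * d * Kb + 1) := ⟨_, rfl⟩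
  obtain ⟨T2, hT2⟩ : ∃ T2 : ℝ, T2 = a ^ 2 / (KDA + 1) := ⟨_, rfl⟩
  have hT10 : 0 < T1 := by rw [hT1]; positivity
  have hT20 : 0 < T2 := by rw [hT2]; positivity
  refine ⟨a, a / 8, min cP₀ (min T1 T2), ha0, by positivity, lt_min hcP₀ (lt_min hT10 hT20), ?_⟩
  intro α₀ α₁ hα₀ hα₁ hguard cs cB cDA hE hE₂ lE lE₂ hcs hcB hcDA hhE hhE₂ hlE hlE₂
  have hS₀ : α₀ + α₁ ≤ cP₀ := hguard.trans (min_le_left _ _)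
  have hS₁ : α₀ + α₁ ≤ T1 := hguard.trans ((min_le_right _ _).trans (min_le_left _ _))
  have hS₂ : α₀ + α₁ ≤ T2 := hguard.trans ((min_le_right _ _).trans (min_le_right _ _))
  obtain ⟨S, hSdef⟩ : ∃ S : ℝ, S = α₀ + α₁ := ⟨_, rfl⟩
  rw [← hSdef] at hS₁ hS₂
  have hS0 : 0 ≤ S := by rw [hSdef]; linarith only [hα₀, hα₁]
  have hα₀S : α₀ ≤ S := by rw [hSdef]; linarith only [hα₁]
  -- the scales in terms of S, and their nonnegativity
  have hcsS : cs = K₁ * S := by rw [hcs, hK₁, hSdef]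
  have hcBS : cB = Kb * S := by rw [hcB, hcsS, hKb]; ring
  have hcDAS : cDA = KDA * S := by rw [hcDA, hcsS, hKDA]; ring
  have hcB0 : 0 ≤ cB := by rw [hcBS]; positivity
  have hcDA0 : 0 ≤ cDA := by rw [hcDAS]; positivity
  -- `40d·c_B ≤ a²`, `c_B ≤ a²`, `c_DA ≤ a²`, `S ≤ a²`
  have h40 : 40 * d * cB ≤ a ^ 2 := by
    rw [hcBS, hT1] at *
    have h₁ : S * (40 * d * Kb + 1) ≤ a ^ 2 := by
      have := mul_le_mul_of_nonneg_right hS₁ (by positivity : (0 : ℝ) ≤ 40 * d * Kb + 1)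
      rwa [div_mul_cancel₀ _ (by positivity : (40 * (d : ℝ) * Kb + 1) ≠ 0)] at this
    nlinarith only [h₁, hS0, hKb0.le, hd0.le]
  have hSa : S ≤ a ^ 2 := by
    have h₁ : S * (40 * d * Kb + 1) ≤ a ^ 2 := by
      have := mul_le_mul_of_nonneg_right hS₁ (by positivity : (0 : ℝ) ≤ 40 * d * Kb + 1)
      rwa [hT1, div_mul_cancel₀ _ (by positivity : (40 * (d : ℝ) * Kb + 1) ≠ 0)] at this
    have h₂ : 0 ≤ 40 * d * Kb * S := by positivity
    nlinarith only [h₁, h₂]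
  have hcBa : cB ≤ a ^ 2 := by
    have : cB ≤ 40 * d * cB := by nlinarith only [hcB0, hd']
    exact this.trans h40
  have hcDAa : cDA ≤ a ^ 2 := by
    rw [hcDAS]
    have h₁ : S * (KDA + 1) ≤ a ^ 2 := by
      have := mul_le_mul_of_nonneg_right hS₂ (by positivity : (0 : ℝ) ≤ KDA + 1)
      rwa [hT2, div_mul_cancel₀ _ (by positivity : (KDA + 1 : ℝ) ≠ 0)] at this
    nlinarith only [h₁, hS0, hKDA0.le]
  have hα₀a : α₀ ≤ a ^ 2 := hα₀S.trans hSa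
  -- the Sect. E sizes at the radius: `hE ≤ a/16`, `hE₂ ≤ 2B₂′C′₂a²`, `lE ≤ 1/2`, `lE₂ ≤ 12B₂′C′₂a`
  have hsum : 40 * d * cB + a ≤ 2 * a := by linarith only [h40, ha2]
  have hsum0 : 0 ≤ 40 * d * cB + a := by positivity
  have hBCa : B₀'H * C2p d * a ≤ 1 / 32 := by linarith only [f5]
  have hhE0 : 0 ≤ hE := by rw [hhE]; positivity
  have hhEle : hE ≤ a / 16 := by
    rw [hhE]
    have h₁ : B₀'H * (C2p d * (40 * d * cB + a) * a) ≤ B₀'H * (C2p d * (2 * a) * a) := by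
      refine mul_le_mul_of_nonneg_left (mul_le_mul_of_nonneg_right (mul_le_mul_of_nonneg_left hsum hC2.le) ha0.le) hB₀'H.le
    have e : B₀'H * (C2p d * (2 * a) * a) = 2 * (B₀'H * C2p d * a) * a := by ring
    rw [e] at h₁
    nlinarith only [h₁, hBCa, ha0.le]
  have hhE₂0 : 0 ≤ hE₂ := by rw [hhE₂]; positivity
  have hhE₂le : hE₂ ≤ 2 * B₂' * C2p d * a ^ 2 := by
    rw [hhE₂]
    have h₁ : B₂' * (C2p d * (40 * d * cB + a) * a) ≤ B₂' * (C2p d * (2 * a) * a) :=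
      mul_le_mul_of_nonneg_left (mul_le_mul_of_nonneg_right (mul_le_mul_of_nonneg_left hsum hC2.le) ha0.le) hB₂'
    have e : B₂' * (C2p d * (2 * a) * a) = 2 * B₂' * C2p d * a ^ 2 := by ring
    linarith only [h₁, e]
  have hsum2 : 40 * d * cB + 2 * a ≤ 3 * a := by linarith only [h40, ha2]
  have hlE0 : 0 ≤ lE := by rw [hlE]; positivity
  have hlEle : lE ≤ 1 / 2 := by
    rw [hlE]
    have h₁ : B₀'H * (4 * C2p d * (40 * d * cB + 2 * a)) ≤ B₀'H * (4 * C2p d * (3 * a)) :=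
      mul_le_mul_of_nonneg_left (mul_le_mul_of_nonneg_left hsum2 (by positivity)) hB₀'H.le
    have e : B₀'H * (4 * C2p d * (3 * a)) = 12 * (B₀'H * C2p d * a) := by ring
    rw [e] at h₁
    linarith only [h₁, hBCa]
  have hlE₂le : lE₂ ≤ 12 * B₂' * C2p d * a := by
    rw [hlE₂]
    have h₁ : B₂' * (4 * C2p d * (40 * d * cB + 2 * a)) ≤ B₂' * (4 * C2p d * (3 * a)) :=
      mul_le_mul_of_nonneg_left (mul_le_mul_of_nonneg_left hsum2 (by positivity)) hB₂'
    have e : B₂' * (4 * C2p d * (3 * a)) = 12 * B₂' * C2p d * a := by ring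
    linarith only [h₁, e]
  -- `b₁ = a/4 + hE ≤ 5a/16 ≤ a/3`
  have hb₁ : a / 4 + hE ≤ a / 3 := by linarith only [hhEle, ha0.le]
  have hb₁0 : 0 ≤ a / 4 + hE := by positivity
  -- the existence side's windows at this (α₀, α₁): keep the α₄-free ones
  obtain ⟨w1, w2, w3, w4, w5, w6, w7, w8, w9, w10, w11, w12, -, -, -, w16, w17, w18, w19, -, -, w22, -, -, -, -, -⟩ :=
    hw₀ α₀ α₁ hα₀ hα₁ (by rw [← hSdef] at hS₀ ⊢; exact hS₀) cs (8 * B₀'' * (5 * (d : ℝ) * L * B₀) * (α₀ + α₁)) cB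
      (2 * (d : ℝ) * (L : ℝ) ^ 2 * cs) _ _ _ _ hcs rfl hcB rfl rfl rfl rfl rfl
  refine ⟨w1, w2, w3, w4, w5, w6, w7, w8, w9, w10, w11, w12, ?_, ?_, ?_, w16, w17, w18, w19, ?_, ?_, w22, ?_, ?_, ?_, ?_, ?_, hlEle, ?_⟩
  · -- 200 C₆ (2α₄) ≤ 1
    linarith only [f2]
  · -- 12000(d+1)L(2α₄) ≤ 1
    linarith only [f3]
  · -- C₄^G (α₀ + 40 d c_B + 8α₄) ≤ 1
    have h₁ : α₀ + 40 * d * cB + 4 * (2 * a) ≤ 10 * a := by linarith only [hα₀a, h40, ha2]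
    have h₂ := mul_le_mul_of_nonneg_left h₁ hC4
    linarith only [h₂, f4]
  · -- 40 d c_B + α₄ ≤ 1/(4B₀′_H·2C′₂)
    have hden : 0 < 4 * B₀'H * (2 * C2p d) := by positivity
    rw [le_div_iff₀ hden]
    have h₁ : (40 * d * cB + a) * (4 * B₀'H * (2 * C2p d)) ≤ (2 * a) * (4 * B₀'H * (2 * C2p d)) := mul_le_mul_of_nonneg_right hsum hden.le
    have e : (2 * a) * (4 * B₀'H * (2 * C2p d)) = 16 * (B₀'H * C2p d * a) := by ring
    rw [e] at h₁
    linarith only [h₁, hBCa]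
  · -- 2C₆(40 d c_B + 4α₄) ≤ 1/8
    have h₁ : 40 * d * cB + 4 * a ≤ 5 * a := by linarith only [h40, ha2]
    have h₂ : 2 * C6 d * (40 * d * cB + 4 * a) ≤ 2 * C6 d * (5 * a) := mul_le_mul_of_nonneg_left h₁ (by positivity)
    linarith only [h₂, f2]
  · -- α₄/4 + hE ≤ 1/24
    linarith only [hb₁, f6]
  · -- α₄/4 + hE ≤ 1/140
    linarith only [hhEle, f6]
  · -- 10(α₄/4 + hE)B_R ≤ 1/2
    have h₁ : 10 * (a / 4 + hE) * BR ≤ 10 * (a / 3) * BR := mul_le_mul_of_nonneg_right (mul_le_mul_of_nonneg_left hb₁ (by norm_num)) hBR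
    nlinarith only [h₁, f7, hBR, ha0.le]
  · -- (1.103): B_G·M ≤ α₄/4 at the radius
    have hmW : mWc d (a / 4 + hE) cB hE₂ cDA ≤ mWc d (a / 3) (a ^ 2) (2 * B₂' * C2p d * a ^ 2) (a ^ 2) :=
      mWc_mono hb₁0 hb₁ hcB0 hcBa hhE₂le hcDAa
    have hmW' := hmW.trans (mWc_le_of_radius ha1)
    rw [← hCm] at hmW'
    have hM : BG * Mc d BR (a / 4 + hE) cB hE₂ cDA ≤ BG * (BR * (2 * (Cm * a ^ 2))) := by
      unfold Mc
      exact mul_le_mul_of_nonneg_left (mul_le_mul_of_nonneg_left (by linarith only [hmW']) hBR) hBG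
    have e : BG * (BR * (2 * (Cm * a ^ 2))) = (8 * BG * BR * Cm * a) * a / 4 := by ring
    rw [e] at hM
    nlinarith only [hM, f8, ha0.le]
  · -- (1.106): B_G·K ≤ 1/2 at the radius
    have hl2 : 1 + lE ≤ 2 := by linarith only [hlEle]
    have hl0 : 0 ≤ 1 + lE := by linarith only [hlE0]
    have hKW : KWc d (a / 4 + hE) cB hE₂ cDA lE₂ (1 + lE) (1 + lE) ≤ KWc d (a / 3) (a ^ 2) (2 * B₂' * C2p d * a ^ 2) (a ^ 2) (12 * B₂' * C2p d * a) 2 2 :=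
      KWc_mono hb₁0 hb₁ hcB0 hcBa hhE₂0 hhE₂le hcDA0 hcDAa hlE₂le hl0 hl2 hl0 hl2
    have hKW' := hKW.trans (KWc_le_of_radius (d := d) hB₂' ha0.le ha1)
    rw [← hCk] at hKW'
    have hmW : mWc d (a / 4 + hE) cB hE₂ cDA ≤ mWc d (a / 3) (a ^ 2) (2 * B₂' * C2p d * a ^ 2) (a ^ 2) :=
      mWc_mono hb₁0 hb₁ hcB0 hcBa hhE₂le hcDAa
    have hmW' := hmW.trans (mWc_le_of_radius ha1)
    rw [← hCm] at hmW'
    have hmW0 : 0 ≤ mWc d (a / 4 + hE) cB hE₂ cDA := by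
      unfold mWc
      have t1 : 0 ≤ (82 : ℝ) * (a / 4 + hE) ^ 2 + 34 * cB * (a / 4 + hE) := by nlinarith only [hb₁0, hcB0]
      have hdd : (0 : ℝ) ≤ d := hd0.le
      nlinarith only [t1, hcDA0, hhE₂0, hdd]
    have hK : Kc d BR (a / 4 + hE) cB hE₂ cDA lE₂ (1 + lE) (1 + lE) ≤ BR * (2 * (Ck * a + 10 * 2 * (BR * (2 * (Cm * a))))) := by
      unfold Kc
      have h₁ : 10 * (1 + lE) * (BR * (2 * mWc d (a / 4 + hE) cB hE₂ cDA)) ≤ 10 * 2 * (BR * (2 * (Cm * a))) := by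
        have hA : BR * (2 * mWc d (a / 4 + hE) cB hE₂ cDA) ≤ BR * (2 * (Cm * a)) :=
          mul_le_mul_of_nonneg_left (by nlinarith only [hmW', ha2, hCm0]) hBR
        have hB' : 0 ≤ BR * (2 * mWc d (a / 4 + hE) cB hE₂ cDA) := mul_nonneg hBR (by linarith only [hmW0])
        exact mul_le_mul (by linarith only [hl2]) hA hB' (by norm_num)
      exact mul_le_mul_of_nonneg_left (mul_le_mul_of_nonneg_left (add_le_add hKW' h₁) (by norm_num)) hBR
    have h₂ := mul_le_mul_of_nonneg_left hK hBG
    have e : BG * (BR * (2 * (Ck * a + 10 * 2 * (BR * (2 * (Cm * a)))))) = (4 * BG * BR * (Ck + 40 * BR * Cm) * a) / 2 := by ring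
    rw [e] at h₂
    linarith only [h₂, f9]
  · -- c_u + h_E ≤ α₄/4
    linarith only [hhEle, ha0.le]

#print axioms uniqWindows_of_guard

end Literature.MathematicalPhysics.QuantumFieldTheory.Balaban1983to89.B8SockP5uEWindows

end
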